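import Literature.NumberTheory.Automorphic.ShimuraCurveHeckeOperatorProofs
import Literature.NumberTheory.Automorphic.ShimuraCurveCuspFormsFiniteDimensionalProofs
import Literature.Probability.RandomPlanarGeometry.HaarSL2R
import HarnessLib

/-!
# The Hecke operators `T_{D,M,n}` are self-adjoint for the Petersson product on `S₂^D(M)`
# (`D > 1`); real eigenvalues and orthogonality of eigenforms (Pasten 2024, §4.9)

A proofs-only companion (theorems only: no definition, no named fact, nothing restated; D-0026) of
`ShimuraCurve.lean` / `ShimuraCurveRibetTakahashi.lean`, written by the seat of the named fact
`Literature.NumberTheory.Automorphic.nonempty_shimuraParametrizationData` (the Jacquet–Langlands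
parametrisation `X₀^D(M) → A_{D,M} ∼ E` of Pasten, *Shimura curves and the abc conjecture*,
J. Number Theory 254 (2024) = arXiv:1705.09251, §2 p. 12). That fact is reduced in the tree to the
Modularity theorem and, for `D > 1`, to the Jacquet–Langlands transfer (§4.10) and Shimura's
construction (§4.11), both of which are statements about the Hecke module `S₂^D(M)` of §4.8–4.9.
After `ShimuraCurveHeckeOperatorProofs` (`T_n ∈ End S₂^D(M)`) and
`ShimuraCurveCuspFormsFiniteDimensionalProofs` (`dim S₂^D(M) < ∞`) this file proves the next
printed statement on that path, the part of Pasten §4.9 p. 15 that does not need the commutativity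
of the Hecke algebra: "`χ` takes values in the ring of integers of a totally real number field. The
associated isotypical subspaces `V^χ_{D,M}` are orthogonal to each other for the Petersson product"
— namely that every `T_{D,M,n}` is **self-adjoint** for the (un-normalised, §4.6 p. 15) Petersson
product `∫_{Γ\ℍ} f ḡ y² dμ`, hence has real eigenvalues and orthogonal eigenspaces. The statement
is Shimura 1971, (3.4.5) with Prop. 3.39 (PDF pp. 96–97 of the held copy): for a Fuchsian group of
the first kind `⟨f|[ΓαΓ]_k, g⟩ = ⟨f, g|[Γα'Γ]_k⟩` with `α' = α^ι` the main involution; here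
`Γ = Γ₀^D(M) = ι(O¹)` and `T_n = Σ_{[a] ∈ Γ\ι(O(n))} [a]`, the set `ι(O(n))` being stable under
`ι` because `ι(x̄) = adj ι(x)` and `x̄ ∈ O` (Diamond–Shurman Thm. 5.5.3 is the case `D = 1`,
proved in the tree as `heckeT_selfAdjoint_holds`).

## Contents (all for a datum `X : ShimuraCurveData D M`; `Γ = X.Gamma`; Mathlib's
## `UpperHalfPlane.petersson k f g τ = conj (f τ) g τ (Im τ)^k`)

1. `setLIntegral_eq_of_isHypFundamentalDomain` — integrals of `Γ`-invariant functions over two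
   a.e. fundamental domains agree (unfolding, `FundamentalDomainUnfolding`).
2. `sum_setLIntegral_out_eq_sum_setLIntegral_involution`,
   `sum_setIntegral_out_eq_sum_setIntegral_involution` — **the unfolding identity**: for a countable
   `S ⊇ Γ S` with finite `Γ\S`, a bijection `σ` of `S` with `σ(γa) = σ(a)γ⁻¹`, and functions `ψ_a`
   with `ψ_{γa} = ψ_a`, `ψ_{aγ} = ψ_a(γ ·)`:  `Σ_{[a]} ∫_F ψ_a = Σ_{[a]} ∫_F ψ_{σa}((σa)⁻¹ ·)`. Both
   sides equal `½ Σ_{a ∈ S} ∫_F 𝟙_F(aτ) ψ_a(τ)`, grouping `S` along left cosets, resp. along the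
   `σ`-images of left cosets; this replaces Shimura's fundamental domains of the finite-index
   subgroups `Γ ∩ α⁻¹Γα` and the common coset representatives of Lemma 3.29/Prop. 3.39.
3. The adjugate involution `a ↦ a' = det(a) a⁻¹` of `GL₂(ℝ)` (`coe_scalar_det_mul_inv`: its matrix is
   `adj a`; `a'' = a`, `a a' = det a`, `(γa)' = a'γ⁻¹`, `f ∣[2] a' = f ∣[2] a⁻¹`), the weight-`2`
   Petersson cocycle `P(F∣g, G∣g) = P(F, G)(g ·)` (`det g > 0`), and
   `ShimuraCurveData.ι_standardInvolution` (`ι(x̄) = adj ι(x)`), whence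
   `scalar_det_mul_inv_mem_heckeSet` (`ι(O(n))' = ι(O(n))`).
4. Bounds for `D > 1`: `exists_bound_norm_mul_im` (`|f| y` bounded), `norm_petersson_two_slash`,
   `integrableOn_petersson_slash(_right)`, `integrableOn_petersson` — the Petersson integrands are
   integrable on every fundamental domain (finite area, `ShimuraCurveFiniteVolume`).
5. The pairing `∫_F P(f, g)` on `S₂^D(M)`, `D > 1`: Hermitian (`setIntegral_petersson_symm`),
   `∫_F P(f, f) = ‖f‖²_F` (`setIntegral_petersson_self`, the tree's `peterssonNormSq`), **positive
   definite** (`peterssonNormSq_pos`, by unfolding and continuity), and **independent of the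
   fundamental domain** (`setIntegral_petersson_eq_of_isHypFundamentalDomain`).
6. **`setIntegral_petersson_heckeFun_comm`** — `∫_F P(T_n f, g) = ∫_F P(f, T_n g)` for all `n`, all
   `f, g ∈ S₂(X.Gamma)` and every fundamental domain `F` (`D > 1`); the same for the endomorphism of
   `exists_linearMap_coe_eq_heckeFun` (`setIntegral_petersson_linearMap_comm`).
7. `conj_eq_of_heckeFun_eq_mul` — eigenvalues of `T_n` on `S₂^D(M)` are real;
   `setIntegral_petersson_eq_zero_of_heckeFun_eq_mul` — eigenforms with distinct `T_n`-eigenvalues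
   are orthogonal.
8. `exists_basis_heckeFun_eigenforms` — **each `T_n` is diagonalisable**: a Petersson-orthonormal
   basis of `S₂^D(M)` of `T_n`-eigenforms with real eigenvalues (spectral theorem for the symmetric
   `T_n` on the finite-dimensional Petersson inner product space; Mathlib
   `LinearMap.IsSymmetric.eigenvectorBasis`).

Not addressed: commutativity of the `T_n` (hence SIMULTANEOUS diagonalisation, the remaining clause
of §4.9), multiplicity one, Jacquet–Langlands.

## References

* H. Pasten, *Shimura curves and the abc conjecture*, J. Number Theory 254 (2024) 214–335 =
  arXiv:1705.09251 (held, read): §4.6 p. 15 (Petersson product), §4.8 p. 15 (Hecke action),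
  §4.9 p. 15 (systems of Hecke eigenvalues). [PastenShimura2024]
* G. Shimura, *Introduction to the arithmetic theory of automorphic functions* (1971), §3.4:
  Prop. 3.39, (3.4.3)–(3.4.5), Thm. 3.41 (held, read: PDF pp. 96–99). [ShimuraIATAF1971]
* F. Diamond, J. Shurman, *A first course in modular forms*, GTM 228 (2005), Prop. 5.5.2,
  Thm. 5.5.3. [DiamondShurman2005]
* H. Iwaniec, *Spectral methods of automorphic forms*, GSM 53 (2002), §2.2 (unfolding over a
  fundamental domain). [Iwaniec2002]
-/

noncomputable section

namespace Literature.NumberTheory.Automorphic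

open _root_.MeasureTheory Set Filter UpperHalfPlane
open scoped MatrixGroups ENNReal ModularForm ComplexConjugate

section General

variable {Γ : Subgroup (GL (Fin 2) ℝ)} {F : Set ℍ}
  (hΓ : Γ ≤ (Matrix.SpecialLinearGroup.toGL : SL(2, ℝ) →* GL (Fin 2) ℝ).range)
  (hneg : (-1 : GL (Fin 2) ℝ) ∈ Γ) (hc : (Γ : Set (GL (Fin 2) ℝ)).Countable)
  (hF : IsHypFundamentalDomain Γ F)
include hΓ hneg hc hF

/-- For a.e. `w ∈ ℍ` exactly two matrices `γ ∈ Γ` move `w` into `F`: `Σ_{γ ∈ Γ} 𝟙_F(γ w) = 2`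
(the tree's `ae_tsum_indicator_inv_smul`, reindexed by `γ ↦ γ⁻¹`). [folklore] -/
theorem ae_tsum_indicator_smul_eq_two :
    ∀ᵐ w : ℍ, (∑' γ : Γ, F.indicator (fun _ => (1 : ℝ≥0∞)) ((γ : GL (Fin 2) ℝ) • w)) = 2 := by
  filter_upwards [ae_tsum_indicator_inv_smul hΓ hneg hc hF (1 : ℝ≥0∞)] with w hw
  rw [← Equiv.tsum_eq (Equiv.inv Γ)]
  simp only [Equiv.inv_apply, Subgroup.coe_inv]
  rw [hw, one_add_one_eq_two]

omit hΓ hneg hc hF in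
/-- Pull-back of an a.e. property along the measure-preserving map `w ↦ a • w` of `ℍ`. [folklore] -/
theorem ae_comp_smul {P : ℍ → Prop} (h : ∀ᵐ w : ℍ, P w) (a : GL (Fin 2) ℝ) :
    ∀ᵐ τ : ℍ, P (a • τ) := by
  have h' : ∀ᵐ w ∂(Measure.map (fun τ : ℍ => a • τ) volume), P w := by
    rw [(measurePreserving_smul a (volume : Measure ℍ)).map_eq]; exact h
  exact ae_of_ae_map (measurable_const_smul a).aemeasurable h'

/-- For a.e. `τ`, `Σ_{γ ∈ Γ} 𝟙_F(γ a τ) = 2` (the previous statement at `w = a τ`). [folklore] -/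
theorem ae_tsum_indicator_smul_smul_eq_two (a : GL (Fin 2) ℝ) :
    ∀ᵐ τ : ℍ, (∑' γ : Γ, F.indicator (fun _ => (1 : ℝ≥0∞)) ((γ : GL (Fin 2) ℝ) • a • τ)) = 2 :=
  ae_comp_smul (ae_tsum_indicator_smul_eq_two hΓ hneg hc hF) a

/-- **Integrals of invariant functions do not depend on the fundamental domain** (Lebesgue
integral): for `Φ ≥ 0` measurable and `Γ`-invariant and two fundamental domains `F, F'` of `Γ`,
`∫_F Φ = ∫_{F'} Φ`. Unfold `𝟙_{F'} Φ` over `F`: `∫_F Φ(w) Σ_γ 𝟙_{F'}(γ w) dμ = 2 ∫_{F'} Φ`, and the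
inner sum is `2` a.e. [cite: Iwaniec2002, §2.2, PDF pp. 28–29] -/
theorem setLIntegral_eq_of_isHypFundamentalDomain {F' : Set ℍ} (hF' : IsHypFundamentalDomain Γ F')
    {Φ : ℍ → ℝ≥0∞} (hΦm : Measurable Φ) (hΦ : ∀ γ ∈ Γ, ∀ w, Φ (γ • w) = Φ w) :
    ∫⁻ w in F, Φ w = ∫⁻ w in F', Φ w := by
  haveI : Countable Γ := hc.to_subtype
  have hm : AEMeasurable (fun w => F'.indicator (fun _ => (1 : ℝ≥0∞)) w * Φ w) volume :=
    ((measurable_const.indicator hF'.measurableSet).mul hΦm).aemeasurable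
  have h := setLIntegral_tsum_smul_eq hΓ hneg hc hF hm
  rw [← lintegral_indicator hF'.measurableSet, show (F'.indicator Φ) =
      fun w => F'.indicator (fun _ => (1 : ℝ≥0∞)) w * Φ w from by
        funext w; by_cases hw : w ∈ F' <;> simp [hw]] at *
  -- the left side of `h` is `∫_F 2 Φ`
  have h2 : ∫⁻ w in F, ∑' γ : Γ, F'.indicator (fun _ => (1 : ℝ≥0∞)) ((γ : GL (Fin 2) ℝ) • w) *
      Φ ((γ : GL (Fin 2) ℝ) • w) = 2 * ∫⁻ w in F, Φ w := by
    rw [← lintegral_const_mul' 2 _ ENNReal.ofNat_ne_top]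
    refine setLIntegral_congr_fun_ae hF.measurableSet ?_
    filter_upwards [ae_tsum_indicator_smul_eq_two hΓ hneg hc hF'] with w hw _
    have : ∀ γ : Γ, F'.indicator (fun _ => (1 : ℝ≥0∞)) ((γ : GL (Fin 2) ℝ) • w) *
        Φ ((γ : GL (Fin 2) ℝ) • w) = F'.indicator (fun _ => (1 : ℝ≥0∞)) ((γ : GL (Fin 2) ℝ) • w) * Φ w :=
      fun γ => by rw [hΦ _ γ.2]
    simp_rw [this, ENNReal.tsum_mul_right, hw]
  rw [h2] at h
  exact (ENNReal.mul_right_inj two_ne_zero ENNReal.ofNat_ne_top).mp h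

end General

/-- A complex Bochner integral in terms of four Lebesgue integrals of non-negative functions
(real and imaginary parts split into positive and negative parts). [folklore] -/
theorem integral_eq_toReal_lintegral_four {α : Type*} [MeasurableSpace α] {μ : Measure α}
    {φ : α → ℂ} (hφ : Integrable φ μ) :
    ∫ x, φ x ∂μ =
      (((∫⁻ x, ENNReal.ofReal (φ x).re ∂μ).toReal - (∫⁻ x, ENNReal.ofReal (-(φ x).re) ∂μ).toReal : ℝ) : ℂ)
        + (((∫⁻ x, ENNReal.ofReal (φ x).im ∂μ).toReal
            - (∫⁻ x, ENNReal.ofReal (-(φ x).im) ∂μ).toReal : ℝ) : ℂ) * Complex.I := by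
  rw [← integral_re_add_im hφ, integral_eq_lintegral_pos_part_sub_lintegral_neg_part hφ.re,
    integral_eq_lintegral_pos_part_sub_lintegral_neg_part hφ.im]
  simp only [RCLike.re_to_complex, RCLike.im_to_complex, RCLike.I_to_complex]
  rfl

/-- `∫⁻ g⁺ < ∞` for a real function `g` dominated by an integrable complex `φ` (used for the four
parts `±Re φ`, `±Im φ`). [folklore] -/
theorem lintegral_ofReal_lt_top_of_abs_le_norm {α : Type*} [MeasurableSpace α] {μ : Measure α}
    {φ : α → ℂ} (hφ : Integrable φ μ) {g : α → ℝ} (hg : ∀ x, |g x| ≤ ‖φ x‖) :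
    ∫⁻ x, ENNReal.ofReal (g x) ∂μ < ⊤ := by
  refine lt_of_le_of_lt (lintegral_mono fun x => ?_) hφ.hasFiniteIntegral
  rw [← ofReal_norm]
  exact ENNReal.ofReal_le_ofReal ((le_abs_self _).trans (hg x))

/-! ### 2. The unfolding identity behind the self-adjointness of Hecke operators -/

section HeckeUnfolding

variable {Γ : Subgroup (GL (Fin 2) ℝ)} {F : Set ℍ}
  (hΓ : Γ ≤ (Matrix.SpecialLinearGroup.toGL : SL(2, ℝ) →* GL (Fin 2) ℝ).range)
  (hneg : (-1 : GL (Fin 2) ℝ) ∈ Γ) (hc : (Γ : Set (GL (Fin 2) ℝ)).Countable)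
  (hF : IsHypFundamentalDomain Γ F)
  {S : Set (GL (Fin 2) ℝ)} (hS : ∀ γ ∈ Γ, ∀ a ∈ S, γ * a ∈ S)

omit hS in
/-- The indicator of `F` composed with a translation is measurable. [folklore] -/
theorem measurable_indicator_smul' (hFm : MeasurableSet F) (a : GL (Fin 2) ℝ) :
    Measurable fun τ : ℍ => F.indicator (fun _ => (1 : ℝ≥0∞)) (a • τ) :=
  (measurable_const.indicator hFm).comp (measurable_const_smul a)

include hΓ hneg hc hF in
/-- **Left-coset unfolding.** For `a ∈ S` and `ψ` with `ψ(γ a) = ψ(a)`: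
`Σ_{γ ∈ Γ} ∫_F 𝟙_F(γ a τ) ψ(γ a)(τ) dμ = 2 ∫_F ψ(a)`. [folklore] -/
theorem tsum_setLIntegral_indicator_mul_smul_eq {ψ : GL (Fin 2) ℝ → ℍ → ℝ≥0∞}
    (hψm : ∀ a ∈ S, Measurable (ψ a)) (h1 : ∀ γ ∈ Γ, ∀ a ∈ S, ψ (γ * a) = ψ a)
    {a : GL (Fin 2) ℝ} (ha : a ∈ S) :
    ∑' γ : Γ, ∫⁻ τ in F, F.indicator (fun _ => (1 : ℝ≥0∞)) (((γ : GL (Fin 2) ℝ) * a) • τ) *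
        ψ ((γ : GL (Fin 2) ℝ) * a) τ = 2 * ∫⁻ τ in F, ψ a τ := by
  haveI : Countable Γ := hc.to_subtype
  have e1 : ∀ γ : Γ, (fun τ => F.indicator (fun _ => (1 : ℝ≥0∞)) (((γ : GL (Fin 2) ℝ) * a) • τ) *
      ψ ((γ : GL (Fin 2) ℝ) * a) τ) = fun τ => F.indicator (fun _ => (1 : ℝ≥0∞))
        ((γ : GL (Fin 2) ℝ) • a • τ) * ψ a τ := by
    intro γ; funext τ; rw [mul_smul, h1 _ γ.2 a ha]
  simp_rw [e1]
  have hmeas : ∀ γ : Γ, AEMeasurable (fun τ => F.indicator (fun _ => (1 : ℝ≥0∞))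
      ((γ : GL (Fin 2) ℝ) • a • τ) * ψ a τ) (volume.restrict F) := fun γ => by
    have hm : Measurable fun τ : ℍ => F.indicator (fun _ => (1 : ℝ≥0∞)) ((γ : GL (Fin 2) ℝ) • a • τ) :=
      (measurable_const.indicator hF.measurableSet).comp
        ((measurable_const_smul (γ : GL (Fin 2) ℝ)).comp (measurable_const_smul a))
    exact (hm.mul (hψm a ha)).aemeasurable
  rw [← lintegral_tsum hmeas]
  simp_rw [ENNReal.tsum_mul_right]
  rw [← lintegral_const_mul' 2 _ ENNReal.ofNat_ne_top]
  refine setLIntegral_congr_fun_ae hF.measurableSet ?_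
  filter_upwards [ae_tsum_indicator_smul_smul_eq_two hΓ hneg hc hF a] with τ hτ _
  rw [show (∑' γ : Γ, F.indicator (fun _ => (1 : ℝ≥0∞)) ((γ : GL (Fin 2) ℝ) • a • τ)) = 2 from hτ]

include hΓ hneg hc hF in
/-- **Right-coset unfolding through the involution.** For `b ∈ GL₂(ℝ)` and `ψ` with
`ψ(b γ)(τ) = ψ(b)(γ τ)` for `γ ∈ Γ`:
`Σ_{γ ∈ Γ} ∫_F 𝟙_F(b γ⁻¹ τ) ψ(b γ⁻¹)(τ) dμ = 2 ∫_F ψ(b)(b⁻¹ τ) dμ`. [folklore] -/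
theorem tsum_setLIntegral_indicator_mul_smul_inv_eq {ψ : GL (Fin 2) ℝ → ℍ → ℝ≥0∞} {b : GL (Fin 2) ℝ}
    (hψb : Measurable (ψ b)) (h2 : ∀ γ ∈ Γ, ∀ τ, ψ (b * γ) τ = ψ b (γ • τ)) :
    ∑' γ : Γ, ∫⁻ τ in F, F.indicator (fun _ => (1 : ℝ≥0∞)) ((b * (γ : GL (Fin 2) ℝ)⁻¹) • τ) *
        ψ (b * (γ : GL (Fin 2) ℝ)⁻¹) τ = 2 * ∫⁻ τ in F, ψ b (b⁻¹ • τ) := by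
  haveI : Countable Γ := hc.to_subtype
  set ind : ℍ → ℝ≥0∞ := F.indicator (fun _ => (1 : ℝ≥0∞)) with hind
  have hindm : Measurable ind := measurable_const.indicator hF.measurableSet
  -- step (i): each term as an integral over `ℍ` after `τ = γ u`
  have e1 : ∀ γ : Γ, ∫⁻ τ in F, ind ((b * (γ : GL (Fin 2) ℝ)⁻¹) • τ) * ψ (b * (γ : GL (Fin 2) ℝ)⁻¹) τ =
      ∫⁻ u, ind ((γ : GL (Fin 2) ℝ) • u) * (ind (b • u) * ψ b u) := by
    intro γ
    have hγ' : ((γ : GL (Fin 2) ℝ))⁻¹ ∈ Γ := Γ.inv_mem γ.2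
    rw [← lintegral_indicator hF.measurableSet]
    have e2 : F.indicator (fun τ => ind ((b * (γ : GL (Fin 2) ℝ)⁻¹) • τ) *
        ψ (b * (γ : GL (Fin 2) ℝ)⁻¹) τ) = fun τ => ind τ * (ind (b • (γ : GL (Fin 2) ℝ)⁻¹ • τ) *
          ψ b ((γ : GL (Fin 2) ℝ)⁻¹ • τ)) := by
      funext τ
      by_cases hτ : τ ∈ F
      · simp only [indicator_of_mem hτ, hind, one_mul, h2 _ hγ' τ, mul_smul]
      · simp only [indicator_of_notMem hτ, hind, zero_mul]
    rw [e2]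
    symm
    calc ∫⁻ u, ind ((γ : GL (Fin 2) ℝ) • u) * (ind (b • u) * ψ b u)
        = ∫⁻ u, (fun τ => ind τ * (ind (b • (γ : GL (Fin 2) ℝ)⁻¹ • τ) *
            ψ b ((γ : GL (Fin 2) ℝ)⁻¹ • τ))) ((γ : GL (Fin 2) ℝ) • u) := by
          simp only [inv_smul_smul]
      _ = ∫⁻ τ, ind τ * (ind (b • (γ : GL (Fin 2) ℝ)⁻¹ • τ) * ψ b ((γ : GL (Fin 2) ℝ)⁻¹ • τ)) :=
          (measurePreserving_smul (γ : GL (Fin 2) ℝ) (volume : Measure ℍ)).lintegral_comp_emb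
            (MeasurableEquiv.smul (γ : GL (Fin 2) ℝ)).measurableEmbedding
            (fun τ => ind τ * (ind (b • (γ : GL (Fin 2) ℝ)⁻¹ • τ) * ψ b ((γ : GL (Fin 2) ℝ)⁻¹ • τ)))
  simp_rw [e1]
  have hmeas : ∀ γ : Γ, AEMeasurable (fun u => ind ((γ : GL (Fin 2) ℝ) • u) * (ind (b • u) * ψ b u))
      volume := fun γ => by
    have hm1 : Measurable fun u : ℍ => ind ((γ : GL (Fin 2) ℝ) • u) :=
      hindm.comp (measurable_const_smul _)
    have hm2 : Measurable fun u : ℍ => ind (b • u) := hindm.comp (measurable_const_smul _)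
    exact (hm1.mul (hm2.mul hψb)).aemeasurable
  rw [← lintegral_tsum hmeas]
  simp_rw [ENNReal.tsum_mul_right]
  -- step (ii): the inner sum is `2` a.e.
  have e3 : ∫⁻ u, (∑' γ : Γ, ind ((γ : GL (Fin 2) ℝ) • u)) * (ind (b • u) * ψ b u) =
      2 * ∫⁻ u, ind (b • u) * ψ b u := by
    rw [← lintegral_const_mul' 2 _ ENNReal.ofNat_ne_top]
    refine lintegral_congr_ae ?_
    filter_upwards [ae_tsum_indicator_smul_eq_two hΓ hneg hc hF] with u hu
    rw [show (∑' γ : Γ, ind ((γ : GL (Fin 2) ℝ) • u)) = 2 from hu]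
  rw [e3]
  -- step (iii): `u = b⁻¹ v`
  congr 1
  have e4 : F.indicator (fun v => ψ b (b⁻¹ • v)) = fun v => ind v * ψ b (b⁻¹ • v) := by
    funext v
    by_cases hv : v ∈ F
    · simp only [indicator_of_mem hv, hind, one_mul]
    · simp only [indicator_of_notMem hv, hind, zero_mul]
  calc ∫⁻ u, ind (b • u) * ψ b u
      = ∫⁻ u, (fun v => ind v * ψ b (b⁻¹ • v)) (b • u) := by simp only [inv_smul_smul]
    _ = ∫⁻ v, ind v * ψ b (b⁻¹ • v) :=
        (measurePreserving_smul b (volume : Measure ℍ)).lintegral_comp_emb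
          (MeasurableEquiv.smul b).measurableEmbedding (fun v => ind v * ψ b (b⁻¹ • v))
    _ = ∫⁻ v in F, ψ b (b⁻¹ • v) := by rw [← lintegral_indicator hF.measurableSet, e4]

include hΓ hneg hc hF hS in
/-- **The unfolding identity** (Lebesgue-integral form). Let `S ⊆ GL₂(ℝ)` be countable with
`Γ S ⊆ S` and finitely many left cosets `Γ \ S` (the setoid `R`), let `σ` be a bijection of `S`
with `σ(γ a) = σ(a) γ⁻¹` (`γ ∈ Γ`), and let `ψ_a ≥ 0` (`a ∈ S`) be measurable functions on `ℍ` with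
`ψ_{γ a} = ψ_a` and `ψ_{a γ} = ψ_a(γ ·)` for `γ ∈ Γ`. Then
`Σ_{[a] ∈ Γ\S} ∫_F ψ_a = Σ_{[a] ∈ Γ\S} ∫_F ψ_{σ a}((σ a)⁻¹ ·)`.
Proof: both sides are `½ Σ_{a ∈ S} ∫_F 𝟙_F(a τ) ψ_a(τ) dμ` — group the sum over `S` along
`S = ⊔_q Γ a_q` (`tsum_setLIntegral_indicator_mul_smul_eq`), respectively along
`S = σ(⊔_q Γ a_q) = ⊔_q σ(a_q) Γ` (`tsum_setLIntegral_indicator_mul_smul_inv_eq`). This is the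
measure-theoretic content of Shimura 1971, Prop. 3.39 / Diamond–Shurman Prop. 5.5.2 (adjoint of a
double coset operator), arranged so that no fundamental domain of a subgroup of finite index and no
decomposition into double cosets is needed. [cite: ShimuraIATAF1971, §3.4 Prop. 3.39 and (3.4.5), PDF pp. 96–97] -/
theorem sum_setLIntegral_out_eq_sum_setLIntegral_involution (R : Setoid S)
    (hR : ∀ a b : S, R a b ↔ ∃ γ ∈ Γ, γ * (a : GL (Fin 2) ℝ) = b) [Fintype (Quotient R)]
    (σ : S ≃ S) (hσ : ∀ (γ : GL (Fin 2) ℝ) (hγ : γ ∈ Γ) (a : S),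
      ((σ ⟨γ * a, hS γ hγ a a.2⟩ : S) : GL (Fin 2) ℝ) = (σ a : GL (Fin 2) ℝ) * γ⁻¹)
    {ψ : GL (Fin 2) ℝ → ℍ → ℝ≥0∞} (hψm : ∀ a ∈ S, Measurable (ψ a))
    (h1 : ∀ γ ∈ Γ, ∀ a ∈ S, ψ (γ * a) = ψ a)
    (h2 : ∀ γ ∈ Γ, ∀ a ∈ S, ∀ τ, ψ (a * γ) τ = ψ a (γ • τ)) :
    ∑ q : Quotient R, ∫⁻ τ in F, ψ (q.out : S) τ =
      ∑ q : Quotient R, ∫⁻ τ in F, ψ (σ q.out) (((σ q.out : S) : GL (Fin 2) ℝ)⁻¹ • τ) := by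
  haveI : Countable Γ := hc.to_subtype
  obtain ⟨G, hG⟩ : ∃ G : GL (Fin 2) ℝ → ℝ≥0∞, ∀ a, G a =
      ∫⁻ τ in F, F.indicator (fun _ => (1 : ℝ≥0∞)) (a • τ) * ψ a τ := ⟨_, fun _ => rfl⟩
  -- the bijection `Γ × (Γ \ S) ≃ S`, `(γ, q) ↦ γ a_q`
  have hmem : ∀ a : S, (a : GL (Fin 2) ℝ) * (((Quotient.mk R a).out : S) : GL (Fin 2) ℝ)⁻¹ ∈ Γ := by
    intro a
    obtain ⟨γ, hγ, h⟩ := (hR _ _).mp (Quotient.mk_out (s := R) a)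
    rw [← h, mul_inv_cancel_right]
    exact hγ
  let e : Γ × Quotient R ≃ S :=
    { toFun := fun p => ⟨(p.1 : GL (Fin 2) ℝ) * (p.2.out : S), hS _ p.1.2 _ p.2.out.2⟩
      invFun := fun a => (⟨(a : GL (Fin 2) ℝ) * (((Quotient.mk R a).out : S) : GL (Fin 2) ℝ)⁻¹,
        hmem a⟩, Quotient.mk R a)
      left_inv := by
        rintro ⟨γ, q⟩
        have hq : Quotient.mk R ⟨(γ : GL (Fin 2) ℝ) * (q.out : S), hS _ γ.2 _ q.out.2⟩ = q := by
          conv_rhs => rw [← Quotient.out_eq q]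
          symm
          exact Quotient.sound ((hR _ _).mpr ⟨γ, γ.2, rfl⟩)
        refine Prod.ext (Subtype.ext ?_) hq
        simp only
        rw [hq, mul_inv_cancel_right]
      right_inv := fun a => Subtype.ext (by simp only; rw [inv_mul_cancel_right]) }
  have he : ∀ (γ : Γ) (q : Quotient R),
      e (γ, q) = ⟨(γ : GL (Fin 2) ℝ) * (q.out : S), hS _ γ.2 _ q.out.2⟩ := fun _ _ => rfl
  -- grouping the sum over `S` in the two ways
  have hsumS : ∑' s : S, G s = ∑ q : Quotient R, ∑' γ : Γ, G ((γ : GL (Fin 2) ℝ) * (q.out : S)) := by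
    rw [← Equiv.tsum_eq e, ENNReal.tsum_prod', ENNReal.tsum_comm, tsum_fintype]
    refine Finset.sum_congr rfl fun q _ => tsum_congr fun γ => ?_
    rw [he]
  have hsumS' : ∑' s : S, G s = ∑ q : Quotient R, ∑' γ : Γ,
      G (((σ q.out : S) : GL (Fin 2) ℝ) * ((γ : GL (Fin 2) ℝ))⁻¹) := by
    rw [← Equiv.tsum_eq σ, ← Equiv.tsum_eq e, ENNReal.tsum_prod', ENNReal.tsum_comm, tsum_fintype]
    refine Finset.sum_congr rfl fun q _ => tsum_congr fun γ => ?_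
    rw [he, hσ _ γ.2]
  -- the two unfoldings
  have hL : ∀ q : Quotient R, ∑' γ : Γ, G ((γ : GL (Fin 2) ℝ) * (q.out : S)) =
      2 * ∫⁻ τ in F, ψ (q.out : S) τ := fun q => by
    simp only [hG]
    exact tsum_setLIntegral_indicator_mul_smul_eq hΓ hneg hc hF hψm h1 q.out.2
  have hR' : ∀ q : Quotient R, ∑' γ : Γ, G (((σ q.out : S) : GL (Fin 2) ℝ) * ((γ : GL (Fin 2) ℝ))⁻¹) =
      2 * ∫⁻ τ in F, ψ (σ q.out) (((σ q.out : S) : GL (Fin 2) ℝ)⁻¹ • τ) := fun q => by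
    simp only [hG]
    exact tsum_setLIntegral_indicator_mul_smul_inv_eq hΓ hneg hc hF (hψm _ (σ q.out).2)
      (fun γ hγ τ => h2 γ hγ _ (σ q.out).2 τ)
  have key : 2 * ∑ q : Quotient R, ∫⁻ τ in F, ψ (q.out : S) τ =
      2 * ∑ q : Quotient R, ∫⁻ τ in F, ψ (σ q.out) (((σ q.out : S) : GL (Fin 2) ℝ)⁻¹ • τ) := by
    rw [Finset.mul_sum, Finset.mul_sum]
    simp_rw [← hL, ← hR']
    rw [← hsumS, ← hsumS']
  exact (ENNReal.mul_right_inj two_ne_zero ENNReal.ofNat_ne_top).mp key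

include hΓ hneg hc hF hS in
/-- **The unfolding identity** (complex form): as `sum_setLIntegral_out_eq_sum_setLIntegral_involution`,
for complex measurable `ψ_a` which, together with the transformed functions `ψ_{σ a}((σ a)⁻¹ ·)`,
are integrable on `F`. (Split into real/imaginary and positive/negative parts.) [cite: ShimuraIATAF1971, §3.4 Prop. 3.39 and (3.4.5), PDF pp. 96–97] -/
theorem sum_setIntegral_out_eq_sum_setIntegral_involution (R : Setoid S)
    (hR : ∀ a b : S, R a b ↔ ∃ γ ∈ Γ, γ * (a : GL (Fin 2) ℝ) = b) [Fintype (Quotient R)]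
    (σ : S ≃ S) (hσ : ∀ (γ : GL (Fin 2) ℝ) (hγ : γ ∈ Γ) (a : S),
      ((σ ⟨γ * a, hS γ hγ a a.2⟩ : S) : GL (Fin 2) ℝ) = (σ a : GL (Fin 2) ℝ) * γ⁻¹)
    {ψ : GL (Fin 2) ℝ → ℍ → ℂ} (hψm : ∀ a ∈ S, Measurable (ψ a))
    (h1 : ∀ γ ∈ Γ, ∀ a ∈ S, ψ (γ * a) = ψ a)
    (h2 : ∀ γ ∈ Γ, ∀ a ∈ S, ∀ τ, ψ (a * γ) τ = ψ a (γ • τ))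
    (hint : ∀ a : S, IntegrableOn (ψ a) F)
    (hint' : ∀ a : S, IntegrableOn (fun τ => ψ (σ a) (((σ a : S) : GL (Fin 2) ℝ)⁻¹ • τ)) F) :
    ∑ q : Quotient R, ∫ τ in F, ψ (q.out : S) τ =
      ∑ q : Quotient R, ∫ τ in F, ψ (σ q.out) (((σ q.out : S) : GL (Fin 2) ℝ)⁻¹ • τ) := by
  /- the identity for a non-negative part `p ∘ ψ`, `p ∈ {Re⁺, Re⁻, Im⁺, Im⁻}` -/
  have part : ∀ (p : ℂ → ℝ), Measurable p →
      ∑ q : Quotient R, ∫⁻ τ in F, ENNReal.ofReal (p (ψ (q.out : S) τ)) =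
        ∑ q : Quotient R, ∫⁻ τ in F,
          ENNReal.ofReal (p (ψ (σ q.out) (((σ q.out : S) : GL (Fin 2) ℝ)⁻¹ • τ))) := by
    intro p hp
    exact sum_setLIntegral_out_eq_sum_setLIntegral_involution hΓ hneg hc hF hS R hR σ hσ
      (ψ := fun a τ => ENNReal.ofReal (p (ψ a τ)))
      (fun a ha => (hp.comp (hψm a ha)).ennreal_ofReal)
      (fun γ hγ a ha => by simp only [h1 γ hγ a ha]) (fun γ hγ a ha τ => by simp only [h2 γ hγ a ha τ])
  /- finiteness of the parts -/
  have fin : ∀ (p : ℂ → ℝ), (∀ z, |p z| ≤ ‖z‖) → ∀ q : Quotient R,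
      ∫⁻ τ in F, ENNReal.ofReal (p (ψ (q.out : S) τ)) ≠ ⊤ :=
    fun p hp q => (lintegral_ofReal_lt_top_of_abs_le_norm (hint q.out) fun τ => hp _).ne
  have fin' : ∀ (p : ℂ → ℝ), (∀ z, |p z| ≤ ‖z‖) → ∀ q : Quotient R,
      ∫⁻ τ in F, ENNReal.ofReal (p (ψ (σ q.out) (((σ q.out : S) : GL (Fin 2) ℝ)⁻¹ • τ))) ≠ ⊤ :=
    fun p hp q => (lintegral_ofReal_lt_top_of_abs_le_norm (hint' q.out) fun τ => hp _).ne
  /- the four parts, as real numbers -/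
  have sums : ∀ (p : ℂ → ℝ), Measurable p → (∀ z, |p z| ≤ ‖z‖) →
      ∑ q : Quotient R, (∫⁻ τ in F, ENNReal.ofReal (p (ψ (q.out : S) τ))).toReal =
        ∑ q : Quotient R, (∫⁻ τ in F,
          ENNReal.ofReal (p (ψ (σ q.out) (((σ q.out : S) : GL (Fin 2) ℝ)⁻¹ • τ)))).toReal := by
    intro p hp hp'
    rw [← ENNReal.toReal_sum fun q _ => fin p hp' q, ← ENNReal.toReal_sum fun q _ => fin' p hp' q,
      part p hp]
  have hRe : ∀ z : ℂ, |z.re| ≤ ‖z‖ := Complex.abs_re_le_norm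
  have hIm : ∀ z : ℂ, |z.im| ≤ ‖z‖ := Complex.abs_im_le_norm
  have hRe' : ∀ z : ℂ, |(-z.re)| ≤ ‖z‖ := fun z => by rw [abs_neg]; exact hRe z
  have hIm' : ∀ z : ℂ, |(-z.im)| ≤ ‖z‖ := fun z => by rw [abs_neg]; exact hIm z
  have s1 := sums (fun z => z.re) Complex.measurable_re hRe
  have s2 := sums (fun z => -z.re) Complex.measurable_re.neg hRe'
  have s3 := sums (fun z => z.im) Complex.measurable_im hIm
  have s4 := sums (fun z => -z.im) Complex.measurable_im.neg hIm'
  have lhs : ∀ q : Quotient R, ∫ τ in F, ψ (q.out : S) τ = _ :=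
    fun q => integral_eq_toReal_lintegral_four (hint q.out)
  have rhs : ∀ q : Quotient R, ∫ τ in F, ψ (σ q.out) (((σ q.out : S) : GL (Fin 2) ℝ)⁻¹ • τ) = _ :=
    fun q => integral_eq_toReal_lintegral_four (hint' q.out)
  simp_rw [lhs, rhs]
  simp only [Finset.sum_add_distrib, ← Finset.sum_mul, ← Complex.ofReal_sum, Finset.sum_sub_distrib,
    s1, s2, s3, s4]

end HeckeUnfolding

/-! ### 3. The adjugate involution `a ↦ a' = det(a) a⁻¹` of `GL₂(ℝ)` -/

section Adjugate

open Matrix Matrix.GeneralLinearGroup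

/-- For a `2 × 2` matrix, `adj(A) = tr(A) · 1 - A` (Cayley–Hamilton). [folklore] -/
theorem adjugate_fin_two_eq_trace_smul_sub {R : Type*} [CommRing R] (A : Matrix (Fin 2) (Fin 2) R) :
    A.adjugate = A.trace • (1 : Matrix (Fin 2) (Fin 2) R) - A := by
  rw [Matrix.adjugate_fin_two, Matrix.trace_fin_two]
  ext i j
  fin_cases i <;> fin_cases j <;> simp

/-- The matrix of `a' := det(a) · a⁻¹ ∈ GL₂(ℝ)` is the adjugate of the matrix of `a`. [folklore] -/
theorem coe_scalar_det_mul_inv (a : GL (Fin 2) ℝ) :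
    ((scalar (Fin 2) (det a) * a⁻¹ : GL (Fin 2) ℝ) : Matrix (Fin 2) (Fin 2) ℝ) =
      (a : Matrix (Fin 2) (Fin 2) ℝ).adjugate := by
  have hdet : IsUnit (a : Matrix (Fin 2) (Fin 2) ℝ).det := by
    rw [← val_det_apply]; exact Units.isUnit _
  rw [Units.val_mul, coe_units_inv, Matrix.inv_def, coe_scalar, scalar_apply, ← smul_eq_diagonal_mul,
    val_det_apply, smul_smul, Ring.mul_inverse_cancel _ hdet, one_smul]

/-- `det(a') = det(a)`. [folklore] -/
theorem det_scalar_det_mul_inv (a : GL (Fin 2) ℝ) : det (scalar (Fin 2) (det a) * a⁻¹) = det a := by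
  ext
  rw [val_det_apply, coe_scalar_det_mul_inv, det_adjugate, val_det_apply]
  simp

/-- `a'' = a`. [folklore] -/
theorem scalar_det_mul_inv_scalar_det_mul_inv (a : GL (Fin 2) ℝ) :
    scalar (Fin 2) (det (scalar (Fin 2) (det a) * a⁻¹)) * (scalar (Fin 2) (det a) * a⁻¹)⁻¹ = a := by
  rw [det_scalar_det_mul_inv, _root_.mul_inv_rev, inv_inv, ← mul_assoc,
    Matrix.GeneralLinearGroup.scalar_commute, mul_assoc, mul_inv_cancel, mul_one]

/-- `a a' = det(a) · 1`. [folklore] -/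
theorem mul_scalar_det_mul_inv (a : GL (Fin 2) ℝ) :
    a * (scalar (Fin 2) (det a) * a⁻¹) = scalar (Fin 2) (det a) := by
  rw [← mul_assoc, ← Matrix.GeneralLinearGroup.scalar_commute, mul_assoc, mul_inv_cancel, mul_one]

/-- `(γ a)' = a' γ⁻¹` when `det γ = 1`. [folklore] -/
theorem scalar_det_mul_inv_mul_left {γ : GL (Fin 2) ℝ} (hγ : det γ = 1) (a : GL (Fin 2) ℝ) :
    scalar (Fin 2) (det (γ * a)) * (γ * a)⁻¹ = scalar (Fin 2) (det a) * a⁻¹ * γ⁻¹ := by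
  rw [map_mul, hγ, one_mul, _root_.mul_inv_rev, mul_assoc]

/-- `a'` acts on `ℍ` as `a⁻¹`. [folklore] -/
theorem scalar_det_mul_inv_smul (a : GL (Fin 2) ℝ) (τ : ℍ) :
    (scalar (Fin 2) (det a) * a⁻¹) • τ = a⁻¹ • τ := by
  rw [mul_smul, glScalar_smul]

/-- `a'⁻¹` acts on `ℍ` as `a`. [folklore] -/
theorem scalar_det_mul_inv_inv_smul (a : GL (Fin 2) ℝ) (τ : ℍ) :
    (scalar (Fin 2) (det a) * a⁻¹)⁻¹ • τ = a • τ := by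
  rw [_root_.mul_inv_rev, inv_inv, ← map_inv, mul_smul, glScalar_smul]

/-- `0 < det(a')` iff `0 < det(a)`. [folklore] -/
theorem det_scalar_det_mul_inv_pos {a : GL (Fin 2) ℝ} (ha : 0 < (det a).val) :
    0 < (det (scalar (Fin 2) (det a) * a⁻¹)).val := by
  rwa [det_scalar_det_mul_inv]

/-- `σ_g = id` for `det g > 0` (Mathlib's `UpperHalfPlane.σ`). [folklore] -/
theorem σ_apply_of_det_pos' {g : GL (Fin 2) ℝ} (hg : 0 < g.det.val) (z : ℂ) : σ g z = z := by
  simp only [val_det_apply] at hg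
  simp [σ, hg]

/-- In weight `2`, scalar matrices slash trivially: `f ∣[2] (u · 1) = f`. [folklore] -/
theorem slash_two_scalar (f : ℍ → ℂ) (u : ℝˣ) :
    f ∣[(2 : ℤ)] (scalar (Fin 2) u : GL (Fin 2) ℝ) = f := by
  funext τ
  have hdet : (det (scalar (Fin 2) u : GL (Fin 2) ℝ)).val = u * u := by
    rw [det_scalar, Fintype.card_fin, Units.val_pow_eq_pow_val, pow_two]
  have hpos : 0 < (det (scalar (Fin 2) u : GL (Fin 2) ℝ)).val := by
    rw [hdet]; exact mul_self_pos.mpr u.ne_zero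
  have habs : |(det (scalar (Fin 2) u : GL (Fin 2) ℝ)).val| = u * u := by
    rw [abs_of_pos hpos, hdet]
  rw [ModularForm.slash_apply, glScalar_smul, denom_scalar, σ_apply_of_det_pos' hpos, habs,
    show (2 : ℤ) - 1 = 1 by norm_num, zpow_one, _root_.zpow_neg, show (2 : ℤ) = ((2 : ℕ) : ℤ) by norm_num,
    zpow_natCast]
  have hu : (u : ℂ) ≠ 0 := by exact_mod_cast u.ne_zero
  push_cast
  field_simp

/-- In weight `2`, `f ∣[2] a' = f ∣[2] a⁻¹`. [folklore] -/
theorem slash_two_scalar_det_mul_inv (f : ℍ → ℂ) (a : GL (Fin 2) ℝ) :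
    f ∣[(2 : ℤ)] (scalar (Fin 2) (det a) * a⁻¹) = f ∣[(2 : ℤ)] a⁻¹ := by
  rw [SlashAction.slash_mul, slash_two_scalar]

/-- **The Petersson cocycle in weight `2`**: `P(F ∣ g, G ∣ g)(τ) = P(F, G)(g τ)` for `det g > 0`
(Mathlib's `petersson_slash` with `|det g|^{k-2} = 1` and `σ_g = id`). [folklore] -/
theorem petersson_two_slash_of_det_pos (F G : ℍ → ℂ) {g : GL (Fin 2) ℝ} (hg : 0 < g.det.val) (τ : ℍ) :
    petersson 2 (F ∣[(2 : ℤ)] g) (G ∣[(2 : ℤ)] g) τ = petersson 2 F G (g • τ) := by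
  rw [petersson_slash, sub_self, zpow_zero, one_mul, σ_apply_of_det_pos' hg]

end Adjugate

/-! ### 4. `ι(O(n))` is stable under the adjugate involution: `ι(x̄) = adj ι(x)` -/

namespace ShimuraCurveData

open Matrix.GeneralLinearGroup

variable {D M : ℕ} (X : ShimuraCurveData D M)

/-- **`ι(x̄) = adj(ι(x))`**: the real splitting intertwines the standard involution of `B` with the
adjugate of `M₂(ℝ)` (`x̄ = trd(x) − x`, `adj(A) = tr(A) − A`, and `tr ι(x) = trd(x)`). [folklore] -/
theorem ι_standardInvolution (x : X.B) :
    X.ι (standardInvolution ℚ X.B x) = (X.ι x).adjugate := by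
  rw [standardInvolution, map_sub, AlgHom.commutes, Algebra.algebraMap_eq_smul_one,
    ← algebraMap_smul ℝ (reducedTrace ℚ X.B x), eq_ratCast, adjugate_fin_two_eq_trace_smul_sub,
    (X.trace_ι_eq_and_det_ι_eq x).1]

/-- **`ι(O(n))` is stable under `a ↦ a' = det(a) a⁻¹`**: for `a = ι(x) ∈ ι(O(n))`,
`a' = adj ι(x) = ι(x̄)` with `x̄ ∈ O` and `det a' = det a = n`. [folklore] -/
theorem scalar_det_mul_inv_mem_heckeSet {n : ℕ} {a : GL (Fin 2) ℝ} (ha : a ∈ X.heckeSet n) :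
    scalar (Fin 2) (det a) * a⁻¹ ∈ X.heckeSet n := by
  obtain ⟨⟨x, hx, hxa⟩, hdet⟩ := ha
  refine ⟨⟨standardInvolution ℚ X.B x, X.isZOrder.standardInvolution_mem hx, ?_⟩, ?_⟩
  · rw [ι_standardInvolution, hxa, coe_scalar_det_mul_inv]
  · rw [coe_scalar_det_mul_inv, Matrix.det_adjugate, hdet]
    simp

/-- Elements of `ι(O(n))`, `n ≥ 1`, have positive determinant `n`. [folklore] -/
theorem det_pos_of_mem_heckeSet {n : ℕ} {a : GL (Fin 2) ℝ} (ha : a ∈ X.heckeSet n) :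
    0 < (det a).val := by
  rw [val_det_apply, ha.2]
  exact_mod_cast X.heckeSet_pos ha


/-! ### 5. Bounds and integrability of the Petersson integrand on a fundamental domain (`D > 1`) -/

/-- **`|f(z)| Im(z)` is bounded on `ℍ` for `f ∈ S₂^D(M)`, `D > 1`** (`|f|² y²` is `Γ`-invariant and
`Γ` has a compact set of representatives; the tree's `norm_sq_mul_im_zpow_le_of_cover`).
[folklore] -/
theorem exists_bound_norm_mul_im (hD : 1 < D) (f : CuspForm X.Gamma 2) :
    ∃ C : ℝ, ∀ z : ℍ, ‖f z‖ * z.im ≤ C := by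
  obtain ⟨K, hK, hcov⟩ := X.exists_isCompact_cover hD
  have hne : K.Nonempty := by
    obtain ⟨γ, -, h⟩ := hcov UpperHalfPlane.I
    exact ⟨_, h⟩
  obtain ⟨zA, -, hmax⟩ := hK.exists_isMaxOn hne
    ((UpperHalfPlane.continuous_im.zpow₀ (2 : ℤ) fun z => Or.inl z.im_ne_zero).continuousOn)
  obtain ⟨C, hC⟩ := hK.exists_bound_of_continuousOn (f.holo'.continuous.continuousOn)
  refine ⟨Real.sqrt (zA.im ^ (2 : ℤ) * C ^ 2), fun z => ?_⟩
  have h := norm_sq_mul_im_zpow_le_of_cover (Γ := X.Gamma) (k := 2) hcov hmax f hC z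
  rw [← Real.sqrt_sq (mul_nonneg (norm_nonneg _) z.im_pos.le)]
  refine Real.sqrt_le_sqrt ?_
  calc (‖f z‖ * z.im) ^ 2 = ‖f z‖ ^ 2 * z.im ^ (2 : ℤ) := by rw [mul_pow, zpow_ofNat]
    _ ≤ _ := h

/-- **The Petersson integrand of a slashed function**: for `det a > 0`,
`|P(F ∣ a, G)(τ)| = (|F(aτ)| Im(aτ)) · (|G(τ)| Im τ)` (as `|(F ∣ a)(τ)| = |F(aτ)| Im(aτ)/Im τ`).
[folklore] -/
theorem norm_petersson_two_slash {a : GL (Fin 2) ℝ} (ha : 0 < (det a).val) (F G : ℍ → ℂ) (τ : ℍ) :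
    ‖petersson 2 (F ∣[(2 : ℤ)] a) G τ‖ = (‖F (a • τ)‖ * (a • τ).im) * (‖G τ‖ * τ.im) := by
  have hd : denom a τ ≠ 0 := denom_ne_zero a τ
  set d : ℝ := ‖denom a τ‖ with hdd
  have hd0 : 0 < d := norm_pos_iff.mpr hd
  have hN : Complex.normSq (denom a τ) = d ^ 2 := by rw [Complex.normSq_eq_norm_sq]
  have habs : |(det a).val| = (det a).val := abs_of_pos ha
  rw [petersson, norm_mul, norm_mul, Complex.norm_conj, ModularForm.slash_apply, norm_mul, norm_mul,
    UpperHalfPlane.norm_σ, UpperHalfPlane.im_smul_eq_div_normSq, hN, habs,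
    show (2 : ℤ) - 1 = 1 by norm_num, zpow_one, Complex.norm_real, Real.norm_of_nonneg ha.le,
    norm_zpow, norm_zpow, Complex.norm_real, Real.norm_of_nonneg τ.im_pos.le, ← hdd, zpow_neg,
    zpow_ofNat, zpow_ofNat]
  field_simp

/-- A bounded continuous function is integrable on a set of finite hyperbolic area. [folklore] -/
theorem integrableOn_of_continuous_of_norm_le {F : Set ℍ} (hvol : volume F < ⊤) {φ : ℍ → ℂ}
    (hφ : Continuous φ) {C : ℝ} (hC : ∀ τ, ‖φ τ‖ ≤ C) : IntegrableOn φ F := by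
  haveI : IsFiniteMeasure (volume.restrict F) := isFiniteMeasure_restrict.mpr hvol.ne
  exact Measure.integrableOn_of_bounded (M := C) hvol.ne hφ.measurable.aestronglyMeasurable
    (Eventually.of_forall hC)

/-- A fundamental domain of `Γ₀^D(M)` has finite area for `D > 1` (the tree's `volume_fd_lt_top`
and `volume_eq_volume_fd`). [cite: VignerasLNM800, Ch. IV §1 Thm. 1.1] -/
theorem volume_lt_top_of_isHypFundamentalDomain (hD : 1 < D) {F : Set ℍ}
    (hF : IsHypFundamentalDomain X.Gamma F) : volume F < ⊤ := by
  rw [X.volume_eq_volume_fd hF]; exact X.volume_fd_lt_top hD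

/-- **The Petersson integrand `P(f ∣ a, g)` is integrable on a fundamental domain** (`D > 1`,
`det a > 0`): it is continuous and bounded by `C_f C_g`. [folklore] -/
theorem integrableOn_petersson_slash (hD : 1 < D) {F : Set ℍ} (hF : IsHypFundamentalDomain X.Gamma F)
    (f g : CuspForm X.Gamma 2) {a : GL (Fin 2) ℝ} (ha : 0 < (det a).val) :
    IntegrableOn (petersson 2 (⇑f ∣[(2 : ℤ)] a) g) F := by
  obtain ⟨Cf, hCf⟩ := X.exists_bound_norm_mul_im hD f
  obtain ⟨Cg, hCg⟩ := X.exists_bound_norm_mul_im hD g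
  refine integrableOn_of_continuous_of_norm_le (X.volume_lt_top_of_isHypFundamentalDomain hD hF)
    (petersson_continuous 2 (f.holo'.slash (2 : ℤ) a).continuous g.holo'.continuous)
    (C := Cf * Cg) fun τ => ?_
  rw [norm_petersson_two_slash ha]
  have hCf0 : 0 ≤ Cf := (mul_nonneg (norm_nonneg _) UpperHalfPlane.I.im_pos.le).trans (hCf _)
  exact mul_le_mul (hCf _) (hCg _) (mul_nonneg (norm_nonneg _) τ.im_pos.le) hCf0

/-- The same with the slash on the right: `P(f, g ∣ a)` is integrable on a fundamental domain.
[folklore] -/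
theorem integrableOn_petersson_slash_right (hD : 1 < D) {F : Set ℍ}
    (hF : IsHypFundamentalDomain X.Gamma F) (f g : CuspForm X.Gamma 2) {a : GL (Fin 2) ℝ}
    (ha : 0 < (det a).val) : IntegrableOn (petersson 2 f (⇑g ∣[(2 : ℤ)] a)) F := by
  obtain ⟨Cf, hCf⟩ := X.exists_bound_norm_mul_im hD f
  obtain ⟨Cg, hCg⟩ := X.exists_bound_norm_mul_im hD g
  refine integrableOn_of_continuous_of_norm_le (X.volume_lt_top_of_isHypFundamentalDomain hD hF)
    (petersson_continuous 2 f.holo'.continuous (g.holo'.slash (2 : ℤ) a).continuous)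
    (C := Cg * Cf) fun τ => ?_
  rw [← petersson_norm_symm, norm_petersson_two_slash ha]
  have hCg0 : 0 ≤ Cg := (mul_nonneg (norm_nonneg _) UpperHalfPlane.I.im_pos.le).trans (hCg _)
  exact mul_le_mul (hCg _) (hCf _) (mul_nonneg (norm_nonneg _) τ.im_pos.le) hCg0

/-- In particular (`a = 1`) **the Petersson integrand of two cusp forms is integrable on a
fundamental domain** of `Γ₀^D(M)`, `D > 1` — convergence of the Petersson product on the compact
Shimura curve (Pasten §4.6 p. 15). [cite: PastenShimura2024, §4.6 p. 15 (Petersson product)] -/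
theorem integrableOn_petersson (hD : 1 < D) {F : Set ℍ} (hF : IsHypFundamentalDomain X.Gamma F)
    (f g : CuspForm X.Gamma 2) : IntegrableOn (petersson 2 f g) F := by
  have h := X.integrableOn_petersson_slash hD hF f g (a := 1) (by simp)
  rwa [SlashAction.slash_one] at h

/-! ### 6. The Petersson pairing on `S₂^D(M)`: symmetry, positivity, independence of the domain -/

/-- **Hermitian symmetry**: `∫_F P(g, f) = conj ∫_F P(f, g)`. [cite: PastenShimura2024, §4.6 p. 15 (Petersson product)] -/
theorem setIntegral_petersson_symm (F : Set ℍ) (f g : ℍ → ℂ) :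
    ∫ τ in F, petersson 2 g f τ = conj (∫ τ in F, petersson 2 f g τ) := by
  rw [← integral_conj]
  exact integral_congr_ae (Eventually.of_forall fun τ => petersson_symm 2 f g τ)

/-- On the diagonal the Petersson integrand is `|f|² y²`, so `∫_F P(f, f)` is the tree's
`peterssonNormSq F f = ‖f‖²_F` (Pasten's `‖f‖²_{U,2}`, §8.1). [cite: PastenShimura2024, §4.6 p. 15 and §8.1 p. 29] -/
theorem setIntegral_petersson_self (F : Set ℍ) (f : ℍ → ℂ) :
    ∫ τ in F, petersson 2 f f τ = (peterssonNormSq F f : ℂ) := by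
  rw [peterssonNormSq, ← integral_complex_ofReal]
  refine integral_congr_ae (Eventually.of_forall fun τ => ?_)
  simp only [petersson, Complex.conj_mul', zpow_ofNat]
  push_cast
  ring

/-- **Positivity**: a non-zero `f ∈ S₂^D(M)` (`D > 1`) has `‖f‖²_F > 0` on every fundamental domain
`F`. If `∫_F |f|² y² = 0` then `|f|² y² = 0` a.e. on `F`; unfolding the `Γ`-invariant function
`|f|² y²` over `F` gives `∫_ℍ |f|² y² = 0`, so `f = 0` by continuity. [folklore] -/
theorem peterssonNormSq_pos (hD : 1 < D) {F : Set ℍ} (hF : IsHypFundamentalDomain X.Gamma F)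
    (f : CuspForm X.Gamma 2) (hf : (⇑f : ℍ → ℂ) ≠ 0) : 0 < peterssonNormSq F f := by
  by_contra hle
  have h0 : peterssonNormSq F f = 0 := le_antisymm (not_lt.mp hle) (peterssonNormSq_nonneg F f)
  set Φ : ℍ → ℝ := fun z => ‖f z‖ ^ 2 * z.im ^ 2 with hΦ
  have hΦc : Continuous Φ := by
    have := f.holo'.continuous
    fun_prop
  have hΦnn : ∀ z, 0 ≤ Φ z := fun z => by positivity
  have hΦinv : ∀ γ ∈ X.Gamma, ∀ z, Φ (γ • z) = Φ z := fun γ hγ z => by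
    have h := norm_sq_mul_im_zpow_smul (k := 2) f hγ z
    simpa only [zpow_ofNat] using h
  -- `Φ = 0` a.e. on `F`
  have hint : IntegrableOn Φ F := by
    have h : IntegrableOn (fun τ => ‖petersson 2 (⇑f) (⇑f) τ‖) F :=
      (X.integrableOn_petersson hD hF f f).norm
    refine h.congr_fun (fun τ _ => ?_) hF.measurableSet
    show ‖petersson 2 (⇑f) (⇑f) τ‖ = Φ τ
    rw [show petersson 2 (⇑f) (⇑f) τ = ((Φ τ : ℝ) : ℂ) by
      simp only [hΦ, petersson, Complex.conj_mul', zpow_ofNat]; push_cast; ring]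
    rw [Complex.norm_real, Real.norm_of_nonneg (hΦnn τ)]
  have hae : ∀ᵐ z ∂(volume.restrict F), Φ z = 0 := by
    have := (integral_eq_zero_iff_of_nonneg_ae (Eventually.of_forall hΦnn) hint).mp h0
    filter_upwards [this] with z hz using hz
  -- unfold: `∫⁻_ℍ Φ = 0`
  haveI : Countable X.Gamma := X.countable_Gamma.to_subtype
  have hlin : ∫⁻ z in F, ENNReal.ofReal (Φ z) = 0 := by
    rw [lintegral_eq_zero_iff' (hΦc.measurable.ennreal_ofReal.aemeasurable)]
    filter_upwards [hae] with z hz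
    simp [hz]
  have hunf := tsum_setLIntegral_smul_eq X.Gamma_le_range_toGL X.neg_one_mem_Gamma X.countable_Gamma hF
    (φ := fun z => ENNReal.ofReal (Φ z)) hΦc.measurable.ennreal_ofReal.aemeasurable
  have hzero : ∑' γ : X.Gamma, ∫⁻ w in F, ENNReal.ofReal (Φ ((γ : GL (Fin 2) ℝ) • w)) = 0 := by
    simp_rw [fun γ : X.Gamma => show (fun w => ENNReal.ofReal (Φ ((γ : GL (Fin 2) ℝ) • w))) =
      fun w => ENNReal.ofReal (Φ w) from funext fun w => by rw [hΦinv _ γ.2], hlin, tsum_zero]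
  rw [hzero] at hunf
  have hall : ∫⁻ w, ENNReal.ofReal (Φ w) = 0 := by
    have := hunf.symm
    simpa using this
  rw [lintegral_eq_zero_iff hΦc.measurable.ennreal_ofReal] at hall
  -- continuity: `Φ = 0` everywhere
  have hΦ0 : (fun w => ENNReal.ofReal (Φ w)) = fun _ => 0 :=
    (Continuous.ae_eq_iff_eq volume (ENNReal.continuous_ofReal.comp hΦc) continuous_const).mp hall
  apply hf
  funext z
  have hz := congrFun hΦ0 z
  simp only [ENNReal.ofReal_eq_zero] at hz
  have hz' : Φ z = 0 := le_antisymm hz (hΦnn z)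
  have : ‖f z‖ ^ 2 = 0 := by
    rcases mul_eq_zero.mp hz' with h | h
    · exact h
    · exact absurd h (pow_ne_zero 2 z.im_pos.ne')
  exact norm_eq_zero.mp (pow_eq_zero_iff two_ne_zero |>.mp this)

/-- **`∫_F P(f, f) ≠ 0` for `f ≠ 0`** (complex form of the positivity). [folklore] -/
theorem setIntegral_petersson_self_ne_zero (hD : 1 < D) {F : Set ℍ}
    (hF : IsHypFundamentalDomain X.Gamma F) (f : CuspForm X.Gamma 2) (hf : (⇑f : ℍ → ℂ) ≠ 0) :
    ∫ τ in F, petersson 2 f f τ ≠ 0 := by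
  rw [setIntegral_petersson_self]
  exact_mod_cast (X.peterssonNormSq_pos hD hF f hf).ne'

/-- **The Petersson pairing does not depend on the fundamental domain** (`D > 1`): for two
fundamental domains `F, F'` of `Γ₀^D(M)`, `∫_F P(f, g) = ∫_{F'} P(f, g)` — the remark "the inner
products `∫_F u v̄ dμ` … do not depend on the choice" of the docstring of `IsHypFundamentalDomain`,
for weight-`2` cusp forms. [cite: Iwaniec2002, §2.2, PDF pp. 28–29] -/
theorem setIntegral_petersson_eq_of_isHypFundamentalDomain (hD : 1 < D) {F F' : Set ℍ}
    (hF : IsHypFundamentalDomain X.Gamma F) (hF' : IsHypFundamentalDomain X.Gamma F')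
    (f g : CuspForm X.Gamma 2) :
    ∫ τ in F, petersson 2 f g τ = ∫ τ in F', petersson 2 f g τ := by
  have hinv : ∀ γ ∈ X.Gamma, ∀ w, petersson 2 (⇑f) (⇑g) (γ • w) = petersson 2 f g w :=
    fun γ hγ w => SlashInvariantFormClass.petersson_smul hγ
  have hm : Measurable (petersson 2 (⇑f) (⇑g)) :=
    (petersson_continuous 2 f.holo'.continuous g.holo'.continuous).measurable
  -- the four non-negative parts
  have key : ∀ (p : ℂ → ℝ), Measurable p →
      ∫⁻ w in F, ENNReal.ofReal (p (petersson 2 f g w)) = ∫⁻ w in F', ENNReal.ofReal (p (petersson 2 f g w)) :=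
    fun p hp => setLIntegral_eq_of_isHypFundamentalDomain X.Gamma_le_range_toGL X.neg_one_mem_Gamma
      X.countable_Gamma hF hF' ((hp.comp hm).ennreal_ofReal) fun γ hγ w => by simp only [hinv γ hγ w]
  rw [integral_eq_toReal_lintegral_four (X.integrableOn_petersson hD hF f g),
    integral_eq_toReal_lintegral_four (X.integrableOn_petersson hD hF' f g),
    key (fun z => z.re) Complex.measurable_re, key (fun z => -z.re) Complex.measurable_re.neg,
    key (fun z => z.im) Complex.measurable_im, key (fun z => -z.im) Complex.measurable_im.neg]

/-! ### 7. Self-adjointness of `T_n` (Pasten §4.9) -/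

/-- The Petersson integrand is additive in the first variable. [folklore] -/
theorem petersson_sum_left {ι : Type*} (s : Finset ι) (Fs : ι → ℍ → ℂ) (G : ℍ → ℂ) (τ : ℍ) :
    petersson 2 (∑ i ∈ s, Fs i) G τ = ∑ i ∈ s, petersson 2 (Fs i) G τ := by
  simp only [petersson, Finset.sum_apply, map_sum, Finset.sum_mul]

/-- The Petersson integrand is additive in the second variable. [folklore] -/
theorem petersson_sum_right {ι : Type*} (s : Finset ι) (F : ℍ → ℂ) (Gs : ι → ℍ → ℂ) (τ : ℍ) :
    petersson 2 F (∑ i ∈ s, Gs i) τ = ∑ i ∈ s, petersson 2 F (Gs i) τ := by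
  simp only [petersson, Finset.sum_apply, Finset.mul_sum, Finset.sum_mul]

/-- **`T_{D,M,n}` is self-adjoint for the Petersson product on `S₂^D(M)`** (`D > 1`, every `n`, every
fundamental domain `F` of `Γ₀^D(M)`):
`∫_F P(T_n f, g) dμ = ∫_F P(f, T_n g) dμ` for `f, g ∈ S₂(X.Gamma)`.
Pasten §4.9 p. 15 records the consequences ("`χ` takes values in the ring of integers of a totally
real number field", "the isotypical subspaces `V^χ` are orthogonal to each other for the Petersson
product"); the statement itself is Shimura 1971 (3.4.5)/Prop. 3.39 for the unit group of an Eichler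
order (the set `ι(O(n))` is stable under the main involution `α ↦ α^ι = adj α`, which fixes every
double coset class function), Diamond–Shurman Thm. 5.5.3 being the case `D = 1`. Proof: with
`T_n f = Σ_{[a] ∈ Γ\ι(O(n))} f ∣ a` and `ψ_a = P(f ∣ a, g)` (so `ψ_{γa} = ψ_a`,
`ψ_{aγ} = ψ_a(γ ·)`), the unfolding identity `sum_setIntegral_out_eq_sum_setIntegral_involution`
for the involution `a ↦ a' = det(a) a⁻¹ = ι(x̄)` of `ι(O(n))` gives
`Σ ∫_F ψ_a = Σ ∫_F ψ_{a'}(a'⁻¹ ·)`, and `ψ_{a'}(a'⁻¹ τ) = P(f, g ∣ a)(τ)` by the weight-`2` cocycle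
(`g = (g ∣ a) ∣ a'` as `a a' = n`). [cite: PastenShimura2024, §4.9 p. 15 (systems of Hecke eigenvalues; orthogonality for the Petersson product)] [cite: ShimuraIATAF1971, §3.4 Prop. 3.39 and (3.4.5), PDF pp. 96–97] -/
theorem setIntegral_petersson_heckeFun_comm (hD : 1 < D) {F : Set ℍ}
    (hF : IsHypFundamentalDomain X.Gamma F) (n : ℕ) (f g : CuspForm X.Gamma 2) :
    ∫ τ in F, petersson 2 (X.heckeFun n f) g τ = ∫ τ in F, petersson 2 f (X.heckeFun n g) τ := by
  classical
  haveI := X.finite_quotient_heckeSetoid hD n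
  letI : Fintype (Quotient (X.heckeSetoid n)) := Fintype.ofFinite _
  -- the involution `a ↦ a'` of `ι(O(n))`
  let σ' : X.heckeSet n ≃ X.heckeSet n :=
    { toFun := fun a => ⟨scalar (Fin 2) (det (a : GL (Fin 2) ℝ)) * (a : GL (Fin 2) ℝ)⁻¹,
        X.scalar_det_mul_inv_mem_heckeSet a.2⟩
      invFun := fun a => ⟨scalar (Fin 2) (det (a : GL (Fin 2) ℝ)) * (a : GL (Fin 2) ℝ)⁻¹,
        X.scalar_det_mul_inv_mem_heckeSet a.2⟩
      left_inv := fun a => Subtype.ext (scalar_det_mul_inv_scalar_det_mul_inv _)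
      right_inv := fun a => Subtype.ext (scalar_det_mul_inv_scalar_det_mul_inv _) }
  have hσ'c : ∀ a : X.heckeSet n, ((σ' a : X.heckeSet n) : GL (Fin 2) ℝ) =
      scalar (Fin 2) (det (a : GL (Fin 2) ℝ)) * (a : GL (Fin 2) ℝ)⁻¹ := fun _ => rfl
  have hσ' : ∀ (γ : GL (Fin 2) ℝ) (hγ : γ ∈ X.Gamma) (a : X.heckeSet n),
      ((σ' ⟨γ * a, X.mul_mem_heckeSet' hγ a.2⟩ : X.heckeSet n) : GL (Fin 2) ℝ) =
        (σ' a : GL (Fin 2) ℝ) * γ⁻¹ := fun γ hγ a => by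
    rw [hσ'c, hσ'c]
    exact scalar_det_mul_inv_mul_left (Subgroup.HasDetOne.det_eq hγ) _
  -- the family `ψ_a = P(f ∣ a, g)`
  have h1 : ∀ γ ∈ X.Gamma, ∀ a ∈ X.heckeSet n,
      petersson 2 (⇑f ∣[(2 : ℤ)] (γ * a)) ⇑g = petersson 2 (⇑f ∣[(2 : ℤ)] a) ⇑g := fun γ hγ a _ => by
    rw [SlashAction.slash_mul, SlashInvariantFormClass.slash_action_eq f γ hγ]
  have h2 : ∀ γ ∈ X.Gamma, ∀ a ∈ X.heckeSet n, ∀ τ,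
      petersson 2 (⇑f ∣[(2 : ℤ)] (a * γ)) ⇑g τ = petersson 2 (⇑f ∣[(2 : ℤ)] a) ⇑g (γ • τ) := by
    intro γ hγ a _ τ
    have hdet : 0 < (det γ).val := by rw [Subgroup.HasDetOne.det_eq hγ]; exact zero_lt_one
    rw [SlashAction.slash_mul]
    conv_lhs => rw [← SlashInvariantFormClass.slash_action_eq g γ hγ]
    exact petersson_two_slash_of_det_pos _ _ hdet τ
  -- the transformed family is `P(f, g ∣ a)`
  have hb : ∀ (a : X.heckeSet n) (τ : ℍ),
      petersson 2 (⇑f ∣[(2 : ℤ)] ((σ' a : X.heckeSet n) : GL (Fin 2) ℝ)) ⇑g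
        (((σ' a : X.heckeSet n) : GL (Fin 2) ℝ)⁻¹ • τ) = petersson 2 ⇑f (⇑g ∣[(2 : ℤ)] (a : GL (Fin 2) ℝ)) τ := by
    intro a τ
    have ha : 0 < (det (a : GL (Fin 2) ℝ)).val := X.det_pos_of_mem_heckeSet a.2
    have hg' : (⇑g : ℍ → ℂ) = (⇑g ∣[(2 : ℤ)] (a : GL (Fin 2) ℝ)) ∣[(2 : ℤ)]
        (scalar (Fin 2) (det (a : GL (Fin 2) ℝ)) * (a : GL (Fin 2) ℝ)⁻¹) := by
      rw [← SlashAction.slash_mul, mul_scalar_det_mul_inv, slash_two_scalar]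
    rw [hσ'c]
    conv_lhs => rw [hg']
    rw [petersson_two_slash_of_det_pos _ _ (det_scalar_det_mul_inv_pos ha), smul_inv_smul]
  -- both sides as sums over `Γ \ ι(O(n))`
  have hdet : ∀ q : Quotient (X.heckeSetoid n), 0 < (det ((q.out : X.heckeSet n) : GL (Fin 2) ℝ)).val :=
    fun q => X.det_pos_of_mem_heckeSet q.out.2
  have eL : ∫ τ in F, petersson 2 (X.heckeFun n f) g τ = ∑ q : Quotient (X.heckeSetoid n),
      ∫ τ in F, petersson 2 (⇑f ∣[(2 : ℤ)] ((q.out : X.heckeSet n) : GL (Fin 2) ℝ)) g τ := by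
    rw [← integral_finsetSum _ fun q _ => X.integrableOn_petersson_slash hD hF f g (hdet q)]
    refine integral_congr_ae (Eventually.of_forall fun τ => ?_)
    rw [X.heckeFun_eq_sum, petersson_sum_left]
  have eR : ∫ τ in F, petersson 2 f (X.heckeFun n g) τ = ∑ q : Quotient (X.heckeSetoid n),
      ∫ τ in F, petersson 2 f (⇑g ∣[(2 : ℤ)] ((q.out : X.heckeSet n) : GL (Fin 2) ℝ)) τ := by
    rw [← integral_finsetSum _ fun q _ => X.integrableOn_petersson_slash_right hD hF f g (hdet q)]
    refine integral_congr_ae (Eventually.of_forall fun τ => ?_)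
    rw [X.heckeFun_eq_sum, petersson_sum_right]
  rw [eL, eR]
  have main := sum_setIntegral_out_eq_sum_setIntegral_involution X.Gamma_le_range_toGL
    X.neg_one_mem_Gamma X.countable_Gamma hF (S := X.heckeSet n)
    (fun γ hγ a ha => X.mul_mem_heckeSet' hγ ha) (X.heckeSetoid n) (fun a b => Iff.rfl) σ' hσ'
    (ψ := fun a => petersson 2 (⇑f ∣[(2 : ℤ)] a) ⇑g)
    (fun a _ => (petersson_continuous 2 (f.holo'.slash (2 : ℤ) a).continuous g.holo'.continuous).measurable)
    h1 h2 (fun a => X.integrableOn_petersson_slash hD hF f g (X.det_pos_of_mem_heckeSet a.2))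
    (fun a => by
      simp_rw [hb a]
      exact X.integrableOn_petersson_slash_right hD hF f g (X.det_pos_of_mem_heckeSet a.2))
  rw [main]
  refine Finset.sum_congr rfl fun q _ => integral_congr_ae (Eventually.of_forall fun τ => ?_)
  exact hb q.out τ

/-- The same for the endomorphism `T` of `S₂^D(M)` of `exists_linearMap_coe_eq_heckeFun`
(`⇑(T h) = T_n h`): `T` is symmetric for the Petersson pairing. [cite: PastenShimura2024, §4.9 p. 15] -/
theorem setIntegral_petersson_linearMap_comm (hD : 1 < D) {F : Set ℍ}
    (hF : IsHypFundamentalDomain X.Gamma F) {n : ℕ} {T : CuspForm X.Gamma 2 →ₗ[ℂ] CuspForm X.Gamma 2}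
    (hT : ∀ h : CuspForm X.Gamma 2, (⇑(T h) : ℍ → ℂ) = X.heckeFun n h) (f g : CuspForm X.Gamma 2) :
    ∫ τ in F, petersson 2 (T f) g τ = ∫ τ in F, petersson 2 f (T g) τ := by
  rw [hT, hT]; exact X.setIntegral_petersson_heckeFun_comm hD hF n f g

/-! ### 8. Real eigenvalues; orthogonality of eigenforms (Pasten §4.9) -/

/-- `P(c f, g) = conj(c) P(f, g)` and `P(f, c g) = c P(f, g)` pointwise. [folklore] -/
theorem petersson_const_mul_left (c : ℂ) (f g : ℍ → ℂ) (τ : ℍ) :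
    petersson 2 (fun z => c * f z) g τ = conj c * petersson 2 f g τ := by
  simp only [petersson, map_mul]; ring

/-- `P(f, c g) = c P(f, g)` pointwise. [folklore] -/
theorem petersson_const_mul_right (c : ℂ) (f g : ℍ → ℂ) (τ : ℍ) :
    petersson 2 f (fun z => c * g z) τ = c * petersson 2 f g τ := by
  simp only [petersson]; ring

/-- **Hecke eigenvalues on `S₂^D(M)` are real** (`D > 1`): if `T_n f = a f` with `f ≠ 0` then
`conj a = a` (Pasten §4.9 p. 15: the systems of eigenvalues `χ` take values in a totally real
field; here the reality of each `χ(T_n)`). From self-adjointness: `conj(a) ‖f‖² = P(T_n f, f) =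
P(f, T_n f) = a ‖f‖²` and `‖f‖² ≠ 0`. [cite: PastenShimura2024, §4.9 p. 15] -/
theorem conj_eq_of_heckeFun_eq_mul (hD : 1 < D) {n : ℕ} {f : CuspForm X.Gamma 2} {a : ℂ}
    (hf : (⇑f : ℍ → ℂ) ≠ 0) (h : X.heckeFun n f = fun τ => a * f τ) : conj a = a := by
  have hF := X.isHypFundamentalDomain_fd
  have key := X.setIntegral_petersson_heckeFun_comm hD hF n f f
  rw [h] at key
  simp_rw [petersson_const_mul_left, petersson_const_mul_right] at key
  rw [integral_const_mul, integral_const_mul] at key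
  exact mul_right_cancel₀ (X.setIntegral_petersson_self_ne_zero hD hF f hf) key

/-- **Eigenforms with distinct `T_n`-eigenvalues are orthogonal** (`D > 1`; Pasten §4.9 p. 15:
"the associated isotypical subspaces `V^χ_{D,M}` are orthogonal to each other for the Petersson
product"): if `T_n f = a f`, `T_n g = b g` and `a ≠ b` then `∫_F P(f, g) = 0` on every fundamental
domain `F`. [cite: PastenShimura2024, §4.9 p. 15] -/
theorem setIntegral_petersson_eq_zero_of_heckeFun_eq_mul (hD : 1 < D) {F : Set ℍ}
    (hF : IsHypFundamentalDomain X.Gamma F) {n : ℕ} {f g : CuspForm X.Gamma 2} {a b : ℂ}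
    (hfa : X.heckeFun n f = fun τ => a * f τ) (hgb : X.heckeFun n g = fun τ => b * g τ)
    (hab : a ≠ b) : ∫ τ in F, petersson 2 f g τ = 0 := by
  by_cases hf : (⇑f : ℍ → ℂ) = 0
  · have : petersson 2 (⇑f) (⇑g) = 0 := by funext τ; simp [petersson, hf]
    rw [this]; simp
  have ha : conj a = a := X.conj_eq_of_heckeFun_eq_mul hD hf hfa
  have key := X.setIntegral_petersson_heckeFun_comm hD hF n f g
  rw [hfa, hgb] at key
  simp_rw [petersson_const_mul_left, petersson_const_mul_right] at key
  rw [integral_const_mul, integral_const_mul, ha] at key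
  have : (a - b) * ∫ τ in F, petersson 2 (⇑f) (⇑g) τ = 0 := by rw [sub_mul, key, sub_self]
  exact (mul_eq_zero.mp this).resolve_left (sub_ne_zero.mpr hab)

/-! ### 9. Each `T_n` is diagonalisable on `S₂^D(M)`, with real eigenvalues and an eigenbasis
orthonormal for the Petersson product -/

/-- Additivity of the Petersson pairing in the first variable (integrated). [folklore] -/
theorem setIntegral_petersson_add_left (hD : 1 < D) {F : Set ℍ} (hF : IsHypFundamentalDomain X.Gamma F)
    (f g h : CuspForm X.Gamma 2) :
    ∫ τ in F, petersson 2 (⇑(f + g)) h τ =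
      (∫ τ in F, petersson 2 f h τ) + ∫ τ in F, petersson 2 g h τ := by
  rw [← integral_add (X.integrableOn_petersson hD hF f h) (X.integrableOn_petersson hD hF g h)]
  refine integral_congr_ae (Eventually.of_forall fun τ => ?_)
  simp only [petersson, CuspForm.coe_add, Pi.add_apply, map_add, add_mul]

/-- `∫_F P(c f, g) = conj(c) ∫_F P(f, g)`. [folklore] -/
theorem setIntegral_petersson_smul_left (F : Set ℍ) (c : ℂ) (f g : CuspForm X.Gamma 2) :
    ∫ τ in F, petersson 2 (⇑(c • f)) g τ = conj c * ∫ τ in F, petersson 2 f g τ := by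
  rw [← integral_const_mul]
  refine integral_congr_ae (Eventually.of_forall fun τ => ?_)
  rw [CuspForm.IsGLPos.coe_smul]
  exact petersson_const_mul_left c f g τ

/-- **`T_{D,M,n}` is diagonalisable on `S₂^D(M)` with real eigenvalues, in a Petersson-orthonormal
eigenbasis** (`D > 1`, every `n`): there are a basis `b₁, …, b_m` of `S₂(X.Gamma)`
(`m = dim S₂^D(M)`) and real numbers `λᵢ` with `T_n bᵢ = λᵢ bᵢ`, and `∫_{X.fd} P(bᵢ, bⱼ) = δᵢⱼ`.
This is the spectral theorem for the self-adjoint `T_n` on the finite-dimensional Petersson inner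
product space `S₂^D(M)` (Pasten §4.9 p. 15, for one operator at a time: "simultaneously
diagonalizable … totally real … orthogonal for the Petersson product"; Shimura 1971, Thm. 3.41 and
the remark after Thm. 3.42, PDF p. 99; simultaneity over all `n` needs the commutativity of the
Hecke algebra, not proved here). [cite: PastenShimura2024, §4.9 p. 15] [cite: ShimuraIATAF1971, §3.4 Thm. 3.41–3.42 and remark, PDF pp. 98–99] -/
theorem exists_basis_heckeFun_eigenforms (hD : 1 < D) (n : ℕ) :
    ∃ (m : ℕ) (b : Module.Basis (Fin m) ℂ (CuspForm X.Gamma 2)) (ev : Fin m → ℝ),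
      (∀ i, X.heckeFun n (b i) = fun τ => (ev i : ℂ) * b i τ) ∧
      ∀ i j, ∫ τ in X.fd, petersson 2 (b i) (b j) τ = if i = j then 1 else 0 := by
  classical
  have hF := X.isHypFundamentalDomain_fd
  haveI : FiniteDimensional ℂ (CuspForm X.Gamma 2) := X.finiteDimensional_cuspForm hD 2
  -- the Petersson inner product space structure on `S₂^D(M)`
  let core : InnerProductSpace.Core ℂ (CuspForm X.Gamma 2) :=
    { inner := fun f g => ∫ τ in X.fd, petersson 2 f g τ
      conj_inner_symm := fun f g => (setIntegral_petersson_symm X.fd g f).symm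
      re_inner_nonneg := fun f => by
        show 0 ≤ RCLike.re (∫ τ in X.fd, petersson 2 (⇑f) (⇑f) τ)
        rw [setIntegral_petersson_self, RCLike.re_to_complex, Complex.ofReal_re]
        exact peterssonNormSq_nonneg _ _
      add_left := fun f g h => X.setIntegral_petersson_add_left hD hF f g h
      smul_left := fun f g c => X.setIntegral_petersson_smul_left X.fd c f g
      definite := fun f hf => by
        by_contra hne
        have hne' : (⇑f : ℍ → ℂ) ≠ 0 := fun h => hne (DFunLike.coe_injective (by
          rw [h]; rfl))
        exact X.setIntegral_petersson_self_ne_zero hD hF f hne' hf }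
  letI : NormedAddCommGroup (CuspForm X.Gamma 2) :=
    @InnerProductSpace.Core.toNormedAddCommGroup ℂ _ _ _ _ core
  letI : InnerProductSpace ℂ (CuspForm X.Gamma 2) := InnerProductSpace.ofCore _
  obtain ⟨T, hT⟩ := X.exists_linearMap_coe_eq_heckeFun hD n
  have hsymm : T.IsSymmetric := fun f g => X.setIntegral_petersson_linearMap_comm hD hF hT f g
  set m := Module.finrank ℂ (CuspForm X.Gamma 2)
  have hm : Module.finrank ℂ (CuspForm X.Gamma 2) = m := rfl
  refine ⟨m, (hsymm.eigenvectorBasis hm).toBasis, hsymm.eigenvalues hm, fun i => ?_, fun i j => ?_⟩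
  · have h := hsymm.apply_eigenvectorBasis hm i
    rw [OrthonormalBasis.coe_toBasis, ← hT, h, CuspForm.IsGLPos.coe_smul]
    funext τ
    simp only [Pi.smul_apply, smul_eq_mul]
    rfl
  · have h := (hsymm.eigenvectorBasis hm).orthonormal
    rw [OrthonormalBasis.coe_toBasis]
    have hij := orthonormal_iff_ite.mp h i j
    exact hij

end ShimuraCurveData


end Literature.NumberTheory.Automorphic

end
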